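import Mathlib
import Summits.KontsevichZagierPeriods.Zeta5Search.Families.SimplexPowerIntegrability
import HarnessLib

/-!
# ζ(5) search — Families: integrability of products of powers of point differences — necessity of the criterion

HONEST FRAMING: systematic search; no irrationality claim unless certified.  This file contains NO statement about
zeta values.  It completes `Families/SimplexPowerIntegrability.lean` (ANALYTIC half of Brown's convergence
criterion [Brown2016, §2.4, Lemma 3.6, Def. 5.1], seat P2) with the CONVERSE direction:

* `lintegral_powProd_eq_top_of_not_crit` — if some run `R` of `1,…,ℓ` consecutive gaps has block functional
  `|R| + Σ_{span ⊆ R} c_i ≤ 0` (a cluster of consecutive finite points carrying total exponent `≤ −(#points − 1)`,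
  i.e. a POLE along the corresponding divisor), then `∫_{simplex} ∏_i len_i^{c_i} = +∞`;
* **`integrableOn_powProd_iff_crit`** — `∏_i (z_{hi i} − z_{lo i})^{c_i}` is integrable on the open simplex IFF the
  block criterion holds.
Proof of the converse: sort the gaps with the run `R` at the LOWEST ranks (`runPerm R`, via `Tuple.sort` of the
indicator key); on the part of that Hepp sector where all free gaps are `≤ 1/(2(ℓ+1))` the integrand dominates
`Kdn · ∏ x_k^{e_k}` (lower comparison of `SectorBounds` and the top gap `≥ 1/2`), and the ordered-sector integral is
`+∞` by `SectorIntegrals` because the tail condition at rank `|R| − 1` is exactly the block functional of `R`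
(`psum_rankExp`).  Standard axioms only.
-/

noncomputable section

open MeasureTheory Set Finset ENNReal

namespace Summit.KontsevichZagierPeriods.Zeta5Search.Families.Cellular

open Sector

variable {ℓ : ℕ}

/-! ### A rank permutation listing a prescribed gap set first -/

/-- Sort key: `0` on `R`, `1` off `R`. -/
def runKey (R : Finset (Fin (ℓ + 1))) (w : Fin (ℓ + 1)) : ℕ := if w ∈ R then 0 else 1

/-- A permutation of the gaps listing the elements of `R` at the lowest ranks. -/
def runPerm (R : Finset (Fin (ℓ + 1))) : Equiv.Perm (Fin (ℓ + 1)) := Tuple.sort (runKey R)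

/-- The key is monotone along `runPerm R`. -/
theorem monotone_runKey (R : Finset (Fin (ℓ + 1))) : Monotone (runKey R ∘ runPerm R) :=
  Tuple.monotone_sort _

/-- The set of ranks occupied by `R` has the cardinality of `R`. -/
theorem card_filter_runPerm_mem (R : Finset (Fin (ℓ + 1))) :
    (univ.filter fun k : Fin (ℓ + 1) => runPerm R k ∈ R).card = R.card := by
  have : (univ.filter fun k : Fin (ℓ + 1) => runPerm R k ∈ R) = R.map (runPerm R).symm.toEmbedding := by
    ext k
    simp only [Finset.mem_filter, Finset.mem_univ, true_and, Finset.mem_map, Equiv.toEmbedding_apply]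
    constructor
    · intro h; exact ⟨runPerm R k, h, (runPerm R).symm_apply_apply k⟩
    · rintro ⟨w, hw, rfl⟩; simpa using hw
  rw [this, Finset.card_map]

/-- The number of ranks below `m ≤ ℓ + 1` is `m`. -/
theorem card_filter_val_lt {m : ℕ} (hm : m ≤ ℓ + 1) :
    (univ.filter fun k : Fin (ℓ + 1) => k.val < m).card = m := by
  have : (univ.filter fun k : Fin (ℓ + 1) => k.val < m) =
      (Finset.range m).attachFin (fun k hk => lt_of_lt_of_le (Finset.mem_range.1 hk) hm) := by
    ext k; simp
  rw [this, Finset.card_attachFin, Finset.card_range]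

/-- The lowest `|R|` ranks of `runPerm R` are exactly the elements of `R`. -/
theorem runPerm_mem_iff (R : Finset (Fin (ℓ + 1))) (k : Fin (ℓ + 1)) : runPerm R k ∈ R ↔ k.val < R.card := by
  have hmono := monotone_runKey R
  -- first: low ranks are in `R`
  have hlow : ∀ k : Fin (ℓ + 1), k.val < R.card → runPerm R k ∈ R := by
    intro k hk
    by_contra hnot
    have hup : ∀ k' : Fin (ℓ + 1), k ≤ k' → runPerm R k' ∉ R := by
      intro k' hkk' hmem
      have h1 := hmono hkk'
      simp only [Function.comp_apply, runKey, if_neg hnot, if_pos hmem] at h1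
      omega
    have hsub : (univ.filter fun k' : Fin (ℓ + 1) => runPerm R k' ∈ R) ⊆ Finset.Iio k := by
      intro k' hk'
      rw [Finset.mem_Iio]
      by_contra hle
      exact hup k' (not_lt.1 hle) (Finset.mem_filter.1 hk').2
    have := Finset.card_le_card hsub
    rw [card_filter_runPerm_mem, Fin.card_Iio] at this
    omega
  constructor
  · intro hk
    have hsub : (univ.filter fun k : Fin (ℓ + 1) => k.val < R.card) ⊆
        (univ.filter fun k : Fin (ℓ + 1) => runPerm R k ∈ R) := by
      intro k' hk'
      simp only [Finset.mem_filter, Finset.mem_univ, true_and] at hk' ⊢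
      exact hlow k' hk'
    have hRle : R.card ≤ ℓ + 1 := by simpa using R.card_le_univ
    have heq := Finset.eq_of_subset_of_card_le hsub (by rw [card_filter_runPerm_mem, card_filter_val_lt hRle])
    have : k ∈ (univ.filter fun k : Fin (ℓ + 1) => runPerm R k ∈ R) := by simp [hk]
    rw [← heq] at this
    simpa using this
  · exact hlow k

/-- With `j + 1 = |R|`, the `j+1` lowest-ranked gaps of `runPerm R` are `R`. -/
theorem lowGaps_runPerm (R : Finset (Fin (ℓ + 1))) (j : Fin (ℓ + 1)) (hj : j.val + 1 = R.card) :
    EdgeFamily.lowGaps (runPerm R) j = R := by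
  ext w
  unfold EdgeFamily.lowGaps
  rw [Finset.mem_filter, Fin.le_def]
  simp only [Finset.mem_univ, true_and]
  rw [show (((runPerm R).symm w).val ≤ j.val) ↔ ((runPerm R).symm w).val < R.card by omega, ← runPerm_mem_iff,
    Equiv.apply_symm_apply]

namespace EdgeFamily

variable {ι : Type*} [Fintype ι] (E : EdgeFamily ℓ ι) (c : ι → ℝ)

/-- A bad run kills the tail condition of the rank exponents of `runPerm R`. -/
theorem not_tailOK_rankExp (R : Finset (Fin (ℓ + 1))) (h1 : 1 ≤ R.card) (hℓ : R.card ≤ ℓ)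
    (hbad : E.blockSum c R ≤ 0) : ¬ TailOK (E.rankExp c (runPerm R)) := by
  intro hT
  set j : Fin ℓ := ⟨R.card - 1, by omega⟩ with hjdef
  have hj := hT j
  have hp := E.psum_rankExp c (runPerm R) j
  rw [lowGaps_runPerm R (Fin.castSucc j) (by rw [Fin.val_castSucc, hjdef]; simp only; omega)] at hp
  have hjv : ((j : ℕ) : ℝ) = ((R.card - 1 : ℕ) : ℝ) := by rw [hjdef]
  linarith

/-! ### Lower bound on the sector of `runPerm R` -/

variable (π : Equiv.Perm (Fin (ℓ + 1)))

/-- Lower bound for the power of the top gap: `d ∈ [1/2, 1]` ⇒ `min 1 ((1/2)^A) ≤ d^A`. -/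
theorem rpow_top_ge {d : ℝ} (h1 : 1 / 2 ≤ d) (h2 : d ≤ 1) (A : ℝ) : min 1 ((1 / 2 : ℝ) ^ A) ≤ d ^ A := by
  have hd : 0 < d := lt_of_lt_of_le (by norm_num) h1
  rcases le_or_gt 0 A with hA | hA
  · exact (min_le_right _ _).trans (Real.rpow_le_rpow (by norm_num) h1 hA)
  · refine (min_le_left _ _).trans ?_
    have := Real.rpow_le_rpow_of_nonpos hd h2 hA.le
    rwa [Real.one_rpow] at this

/-- **Transfer from the small ordered sector** (pointwise): if the relabelled free gaps lie in
`sectorSet ℓ (1/(2(ℓ+1)))` then `h ∈ gapSet`, the full gap vector is sorted along `π`, and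
`Kdn · mono (rankExp) (h ∘ ρ) ≤ Ψ_π(extGap h)`. -/
theorem le_sectorFun_extGap (h : Fin ℓ → ℝ) :
    (compRankCoord π ⁻¹' sectorSet ℓ (1 / (2 * (ℓ + 1 : ℝ)))).indicator
        (fun h => ENNReal.ofReal (min 1 ((1 / 2 : ℝ) ^ E.aggExp π c (π (Fin.last ℓ)))) *
          ENNReal.ofReal (mono (E.rankExp c π) (h ∘ rankCoord π))) h ≤
      (gapSet ℓ).indicator (fun h => E.sectorFun c π (extGap (π (Fin.last ℓ)) h)) h := by
  by_cases hx : h ∈ compRankCoord π ⁻¹' sectorSet ℓ (1 / (2 * (ℓ + 1 : ℝ)))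
  · rw [indicator_of_mem hx]
    have hx' : h ∘ rankCoord π ∈ sectorSet ℓ (1 / (2 * (ℓ + 1 : ℝ))) := by
      simpa only [Set.mem_preimage, compRankCoord_apply] using hx
    obtain ⟨hpos, hcap, hmono⟩ := hx'
    have hL : (0 : ℝ) < ℓ + 1 := by positivity
    -- `h` itself is positive with small sum
    have hposh : ∀ j, 0 < h j := fun j => by
      have := hpos ((rankCoord π).symm j)
      simpa only [Function.comp_apply, Equiv.apply_symm_apply] using this
    have hsum : ∑ j, h j ≤ 1 / 2 := by
      calc ∑ j, h j = ∑ k, h (rankCoord π k) := (Equiv.sum_comp (rankCoord π) h).symm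
        _ ≤ ∑ _k : Fin ℓ, (1 / (2 * (ℓ + 1 : ℝ))) := Finset.sum_le_sum fun k _ => hcap k
        _ = ℓ * (1 / (2 * (ℓ + 1 : ℝ))) := by simp
        _ ≤ 1 / 2 := by
            rw [mul_one_div, div_le_div_iff₀ (by positivity) (by norm_num)]
            nlinarith
    have hgap : h ∈ gapSet ℓ := ⟨hposh, by linarith⟩
    have htop : 1 / 2 ≤ extGap (π (Fin.last ℓ)) h (π (Fin.last ℓ)) := by rw [extGap_apply_top]; linarith
    have htop1 : extGap (π (Fin.last ℓ)) h (π (Fin.last ℓ)) ≤ 1 := by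
      rw [extGap_apply_top]
      linarith [Finset.sum_nonneg fun j (_ : j ∈ Finset.univ) => (hposh j).le]
    -- the full gap vector is sorted along `π`
    have hsorted : Sorted π (extGap (π (Fin.last ℓ)) h) := by
      intro k k' hkk'
      simp only [Function.comp_apply]
      rcases Fin.eq_castSucc_or_eq_last k' with ⟨k1, rfl⟩ | rfl
      · rcases Fin.eq_castSucc_or_eq_last k with ⟨k0, rfl⟩ | rfl
        · rw [extGap_apply_rank, extGap_apply_rank]
          exact hmono k0 k1 (Fin.castSucc_le_castSucc_iff.1 hkk')
        · exact absurd hkk' (not_le.2 (Fin.castSucc_lt_last k1))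
      · rcases Fin.eq_castSucc_or_eq_last k with ⟨k0, rfl⟩ | rfl
        · rw [extGap_apply_rank]
          calc h (rankCoord π k0) ≤ 1 / (2 * (ℓ + 1 : ℝ)) := hcap k0
            _ ≤ 1 / 2 := by
                rw [div_le_div_iff₀ (by positivity) (by norm_num)]; nlinarith
            _ ≤ _ := htop
        · exact le_rfl
    rw [indicator_of_mem hgap, sectorFun, indicator_of_mem (show extGap (π (Fin.last ℓ)) h ∈ sortedSet π from
      hsorted), aggMono_extGap_eq, ← ENNReal.ofReal_mul (le_min zero_le_one (Real.rpow_nonneg (by norm_num) _))]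
    refine ENNReal.ofReal_le_ofReal ?_
    gcongr
    · exact (mono_pos _ hpos).le
    · exact rpow_top_ge htop htop1 _
  · rw [indicator_of_notMem hx]
    exact zero_le

/-- **The sector integral is infinite** when the tail condition fails. -/
theorem lintegral_sectorFun_eq_top (hT : ¬ TailOK (E.rankExp c π)) :
    ∫⁻ t in openSimplex ℓ, E.sectorFun c π (fun w => gapN t w) = ⊤ := by
  rw [lintegral_openSimplex_eq_gapSet_extGap (E.sectorFun c π) (E.measurable_sectorFun c π) (π (Fin.last ℓ)),
    ← lintegral_indicator (measurableSet_gapSet ℓ)]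
  set cap : ℝ := 1 / (2 * (ℓ + 1 : ℝ)) with hcapdef
  have hcap : 0 < cap := by positivity
  have hSm : MeasurableSet (compRankCoord π ⁻¹' sectorSet ℓ cap) :=
    (measurableSet_sectorSet ℓ cap).preimage (compRankCoord π).measurable
  have hFm : Measurable fun h : Fin ℓ → ℝ => ENNReal.ofReal (mono (E.rankExp c π) (h ∘ rankCoord π)) :=
    ((measurable_mono _).comp (compRankCoord π).measurable).ennreal_ofReal
  refine eq_top_iff.2 (le_trans ?_ (lintegral_mono fun h => E.le_sectorFun_extGap c π h))
  rw [lintegral_indicator hSm, lintegral_const_mul _ hFm]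
  have := (measurePreserving_compRankCoord π).setLIntegral_comp_preimage (measurableSet_sectorSet ℓ cap)
    ((measurable_mono (E.rankExp c π)).ennreal_ofReal)
  simp only [compRankCoord_apply] at this
  rw [this]
  have htop : ∫⁻ x in sectorSet ℓ cap, ENNReal.ofReal (mono (E.rankExp c π) x) = ⊤ := by
    by_contra hne
    exact hT ((lintegral_sectorSet_mono_lt_top_iff ℓ hcap _).1 (lt_top_iff_ne_top.2 hne))
  rw [htop, ENNReal.mul_top]
  rw [Ne, ENNReal.ofReal_eq_zero, not_le]
  exact lt_min one_pos (Real.rpow_pos_of_pos (by norm_num) _)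

/-- **Necessity of the criterion**: a bad run makes the integral infinite. [Brown2016, Lemma 3.6, direction
"a pole along `δ⁰_f` ⇒ divergence", for products of powers of point differences] -/
theorem lintegral_powProd_eq_top_of_not_crit {c : ι → ℝ} (hc : ¬ E.Crit c) :
    ∫⁻ t in openSimplex ℓ, ENNReal.ofReal (E.powProd c t) = ⊤ := by
  unfold Crit at hc
  push Not at hc
  obtain ⟨p, q, hpq, hq, hqp, hbad⟩ := hc
  set R := gapRun ℓ p q with hR
  have hcard : R.card = q - p := by rw [hR, card_gapRun p q hq]
  set π := runPerm R with hπ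
  have hT : ¬ TailOK (E.rankExp c π) := E.not_tailOK_rankExp c R (by omega) (by omega) hbad
  have hsec := E.lintegral_sectorFun_eq_top c π hT
  have hm : Measurable fun t : Fin ℓ → ℝ => E.sectorFun c π (fun w => gapN t w) :=
    (E.measurable_sectorFun c π).comp measurable_gaps
  have hle : ∫⁻ t in openSimplex ℓ, ENNReal.ofReal (Klo ℓ c) * E.sectorFun c π (fun w => gapN t w) ≤
      ∫⁻ t in openSimplex ℓ, ENNReal.ofReal (E.powProd c t) := by
    refine setLIntegral_mono (E.measurable_powProd c).ennreal_ofReal fun t ht => ?_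
    rw [sectorFun]
    by_cases hs : (fun w : Fin (ℓ + 1) => gapN t w) ∈ sortedSet π
    · rw [indicator_of_mem hs, ← ENNReal.ofReal_mul (Klo_pos c).le]
      exact ENNReal.ofReal_le_ofReal (E.aggMono_le_powProd π c ht hs)
    · rw [indicator_of_notMem hs, mul_zero]; exact zero_le
  rw [lintegral_const_mul _ hm, hsec, ENNReal.mul_top] at hle
  · exact eq_top_iff.2 hle
  · rw [Ne, ENNReal.ofReal_eq_zero, not_le]; exact Klo_pos c

/-- **Integrability criterion for products of powers of point differences on the simplex**:
`∏_i (z_{hi i} − z_{lo i})^{c_i}` is integrable on `0 < t₁ < ⋯ < t_ℓ < 1` iff every run `R` of `1,…,ℓ`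
consecutive gaps has `|R| + Σ_{span i ⊆ R} c_i > 0`. [Brown2016, §2.4 / Lemma 3.6, analytic content] -/
theorem integrableOn_powProd_iff_crit (c : ι → ℝ) : IntegrableOn (E.powProd c) (openSimplex ℓ) ↔ E.Crit c := by
  constructor
  · intro hint
    by_contra hc
    have h := E.lintegral_powProd_eq_top_of_not_crit hc
    have hfin := hint.2
    rw [hasFiniteIntegral_iff_ofReal ((ae_restrict_iff' (measurableSet_openSimplex ℓ)).2
      (ae_of_all _ fun t ht => (E.powProd_pos c ht).le)), h] at hfin
    exact lt_irrefl _ hfin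
  · exact E.integrableOn_powProd_of_crit

end EdgeFamily

end Summit.KontsevichZagierPeriods.Zeta5Search.Families.Cellular
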